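import Summits.BirchSwinnertonDyer.BirchSwinnertonDyer.Theorems.KimAtThreeFineKatoHLogDualUnit
import Summits.BirchSwinnertonDyer.BirchSwinnertonDyer.Theorems.KimAtThreeDeepUpperExpStarFacts
import Summits.BirchSwinnertonDyer.BirchSwinnertonDyer.Theorems.KimAtThreeDeepLowerExpStarOmegaRes
import Summits.BirchSwinnertonDyer.BirchSwinnertonDyer.Theorems.KimAtThreeFineKatoSATPointsRat
import Literature.NumberTheory.PAdicHodge.DualExpEllipticTower
import HarnessLib

/-!
# DUALINT at a factor field from the print fact (S5b-tower): the range of the defined `exp*_{d_w}` is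
# integrally dual to the logarithm (cell `bsd-addord`, seat w2-acc4 gen 5 = owner of `hLog₀`; helper)

HONEST FRAMING.  Crux 19560 `KatoKuriharaPortThreeShared`; part hLog₀ ⟸ `perFactorLog_of_dualInt`
(p511995) ⟸ the displayed hDualTame / hDualWild (= DUALINT).  THIS FILE proves DUALINT in its DUAL FORM
at ANY factor field `L ⊇ ℚ_v` (v = the place of `ℚ` over `3`), from the cite fact (S5b-tower)
(`Literature.NumberTheory.PAdicHodge.exists_smul_range_expStarCoord_tower_iff_trace_log`, w2-c3 p511026)
taken as a hypothesis `hS`: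

* `dualInt_of_towerFact` (stated in the fact's own currency: `dw` a line datum of the TOWER representation
  `(restrictedRationalTateRep W ℚ_v 3).restrict (absGaloisRestrict ℚ_v L)` — definitionally the cell's
  `localRationalTateRep W 3 ((galRestrictPlace v₀).comp _)`, `localRationalTateRep_comp` — and (RES) at cocycle
  level, `expStarCoordTower` for `exp*_{dw}`; the bridge to hLog₀'s class-level `expStarOmegaHom` is
  `expStarOmega_oneCocycleClass` + `cohomologyRes_oneCocycleClass`) — for a Kato-stratum row (`Addv W 3`, `3 ∤ c₃`, `#E(ℚ₃)[3] = 1`), an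
  `hdual`-normalised line datum `d` at `ℚ_v` and a line datum `dw` at `L` compatible under restriction
  ((RES_w) of hKatoV2₀, class level), and ANY compatible integral `ℝ≥0`-valuation `wL` on `L`:
  **`‖Tr_{L/ℚ₃}(exp*_{dw}(z) · log_{wL} P′)‖ ≤ 1`** for every class `z ∈ H¹(Γ_L, T₃W)` and every point
  `P′ ∈ E(L)`.
  Proof: (S5b-tower) at `(F₀, F) = (ℚ_v, L)` gives ONE `e ∈ ℚ_vˣ` normalising both levels; at `ℚ_v` the
  transported statement (w2-c3's `hdual_of_facts` template: `Tr_{ℚ_v/ℚ₃} = e₃⁻¹`, points and logarithms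
  along `e₃⁻¹`) and `hdual` say that `exp*_{e•d}` and `exp*_d = e · exp*_{e•d}` BOTH have range the unit
  ball (`dual_{ℚ₃} = ℤ₃` on the Kato stratum, kim3's `forall_norm_mul_padicLog_le_one_iff_three`), so
  `‖e‖₃ = 1` (`norm_eq_one_of_forall_iff_norm_le_one`); at `L`, `range(exp*_{e•dw}) = dual_{wL}` and
  `exp*_{dw} = e · exp*_{e•dw}` give the claim (`forall_norm_apply_mul_le_one_of_range`; `e` acts through
  `ℚ₃ → L` by the rigidity of ring maps `ℚ₃ → L`).

What is NOT here (the last step to hDualTame / hDualWild): the identification of the K-port sets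
`Λ₀ = {Λ̃ P}` with logarithms `log_{wL} P′` of points of `W ⊗ L` (w2-kport (J4)), and for the wild sets the
log base change along `ι`; and the cite fact (S5b-tower) itself stays a hypothesis.  TOOL theorem only (no
definition, no named fact, no `sorry`); closes nothing; nothing booked; BSD / 19560 not proved by any of this.

References: S. Bloch, K. Kato (1990) §3 Prop. 3.8, Ex. 3.11 [BlochKato1990]; K. Kato, LNM 1553 (1993) Ch. II
§1.2.4, Thm. 1.4.1 [Kato1993LNM1553]; C.-H. Kim, AJM 148 (2026) Lemma 3.10 [Kim2022StructureSelmer];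
J.-P. Serre, *Local Fields* (1979) II §5 [SerreLocalFields1979].
-/

noncomputable section

-- the cell's Theorems namespace `Summit.BirchSwinnertonDyer.BirchSwinnertonDyer.…` repeats the summit name by design (D-0017)
set_option linter.dupNamespace false

open scoped TensorProduct NumberField NNReal WithZero Classical
open Field ValuativeRel Function IsDedekindDomain NumberField
open Literature.NumberTheory.GaloisRepresentations
open Literature.NumberTheory.GaloisRepresentations.PeriodRingData
open Literature.NumberTheory.GaloisRepresentations.IsNonarchimedeanLocalField
open Literature.NumberTheory.GaloisCohomology
open Literature.NumberTheory.PAdicHodge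
open Literature.NumberTheory.EllipticCurves WeierstrassCurve
open Literature.NumberTheory.EllipticCurves.FormalGroupChart
open Literature.NumberTheory.EllipticCurves.Rank1Residual
open Summit.BirchSwinnertonDyer.BirchSwinnertonDyer.Theorems.KimAtThreeDeepLowerExpStarOmega
open Summit.BirchSwinnertonDyer.BirchSwinnertonDyer.Theorems.KimAtThreeDeepLowerExpStarOmegaPlace
open Summit.BirchSwinnertonDyer.BirchSwinnertonDyer.Theorems.KimAtThreeDeepLowerExpStarOmegaRes
open Summit.BirchSwinnertonDyer.BirchSwinnertonDyer.Theorems.KimAtThreeDeepUpperExpStarTransport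
open Summit.BirchSwinnertonDyer.BirchSwinnertonDyer.Theorems.KimAtThreeDeepUpperExpStarFacts
open Summit.BirchSwinnertonDyer.BirchSwinnertonDyer.Theorems.KimAtThreeFineKatoSATPointsRat
open Summit.BirchSwinnertonDyer.Rank1Residual.GaloisImage
open Summit.BirchSwinnertonDyer.Rank1Residual.Additive (LocalLog.padicLog)
open Summit.BirchSwinnertonDyer.Rank1Residual.Additive.LocalLog
open Rat.HeightOneSpectrum

namespace Summit.BirchSwinnertonDyer.BirchSwinnertonDyer.Theorems.KimAtThreeFineKatoHLog

attribute [local instance 100000] NumberField.Place.instAlgebraCompletion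
attribute [local instance] valuativeRelPlace topologicalSpacePlace
attribute [local instance] isNonarchimedeanLocalField_place charZero_place
attribute [local instance] padicAlgebraPlace fact_not_isUnit_place isAdicComplete_place

/-- The place of `ℚ` over `3`. -/
private abbrev v₀ : HeightOneSpectrum (𝓞 ℚ) := (primesEquiv (R := 𝓞 ℚ)).symm ⟨3, Nat.prime_three⟩

/-- `3 ∈ v₀` (the `Fact` the local `Place` instances are indexed by). -/
private theorem fact_three_mem : Fact (((3 : ℕ) : 𝓞 ℚ) ∈ (v₀).asIdeal) :=
  ⟨(Literature.NumberTheory.EllipticCurves.natCast_mem_asIdeal_iff_eq_primesEquiv_symm _ Nat.prime_three).mpr rfl⟩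

attribute [local instance] fact_three_mem

variable {L : Type} [Field L] [ValuativeRel L] [TopologicalSpace L] [IsNonarchimedeanLocalField L]
  [CharZero L] [Algebra (Place.Completion (Sum.inr v₀ : Place ℚ)) L]
  [IsScalarTower ℚ (Place.Completion (Sum.inr v₀ : Place ℚ)) L]
  [Fact (¬ IsUnit ((3 : ℕ) : integerC L))] [IsAdicComplete (Ideal.span {((3 : ℕ) : integerC L)}) (integerC L)]
  (hL : valuation L (3 : ℕ) < 1) [Algebra ℚ_[3] L]

/-- **DUALINT at a factor field from (S5b-tower).**  See the module docstring. -/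
theorem dualInt_of_towerFact (hS : exists_smul_range_expStarCoord_tower_iff_trace_log)
    (W : WeierstrassCurve ℚ) [W.IsElliptic] [W.IsGloballyMinimal]
    (hadd : Addv W 3) (hc : ¬ 3 ∣ (W.baseChange ℚ_[3]).localTamagawaNumber ℤ_[3])
    (ht : Nat.card {Q : (W.baseChange ℚ_[3]).toAffine.Point // (3 : ℕ) • Q = 0} = 1)
    (d : LocalNeronLineAt W 3 v₀)
    (hinj : (bdRPeriodRingData (valuation_place_lt_one 3 v₀)).CupLogInjective (logCyclotomic 3)
      (localRationalTateRep W 3 (galRestrictPlace v₀)))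
    (hex : ∀ z : contOneCocycles (localRationalTateRep W 3 (galRestrictPlace v₀)).toTopRep,
      (bdRPeriodRingData (valuation_place_lt_one 3 v₀)).HasDualExp (logCyclotomic 3)
        (localRationalTateRep W 3 (galRestrictPlace v₀)) fun σ => z.1 σ)
    (hdual : ∀ a : ℚ_[3], (∃ y, expStarOmegaPadicAt d hinj hex
        (((Padic.adicCompletionEquiv (𝓞 ℚ) ⟨3, Nat.prime_three⟩).symm :
          (v₀).adicCompletion ℚ →+* ℚ_[3])) y = a) ↔
      ∀ Q : (W.baseChange ℚ_[3]).toAffine.Point, ‖a * padicLog (W.baseChange ℚ_[3]) Q‖ ≤ 1)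
    (dw : (bdRPeriodRingData hL).FilZeroLine
      ((restrictedRationalTateRep W (Place.Completion (Sum.inr v₀ : Place ℚ)) 3).restrict
        (absGaloisRestrict (Place.Completion (Sum.inr v₀ : Place ℚ)) L)))
    (hinjw : (bdRPeriodRingData hL).CupLogInjective (logCyclotomic 3)
      ((restrictedRationalTateRep W (Place.Completion (Sum.inr v₀ : Place ℚ)) 3).restrict
        (absGaloisRestrict (Place.Completion (Sum.inr v₀ : Place ℚ)) L)))
    (hexw : ∀ z : contOneCocycles ((restrictedRationalTateRep W (Place.Completion (Sum.inr v₀ : Place ℚ)) 3).restrict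
        (absGaloisRestrict (Place.Completion (Sum.inr v₀ : Place ℚ)) L)).toTopRep,
      (bdRPeriodRingData hL).HasDualExp (logCyclotomic 3)
        ((restrictedRationalTateRep W (Place.Completion (Sum.inr v₀ : Place ℚ)) 3).restrict
          (absGaloisRestrict (Place.Completion (Sum.inr v₀ : Place ℚ)) L)) fun σ => z.1 σ)
    (hresw : ∀ (η₀ : contOneCocycles (restrictedTateRep W (Place.Completion (Sum.inr v₀ : Place ℚ)) 3).toTopRep)
        (η : contOneCocycles ((restrictedTateRep W (Place.Completion (Sum.inr v₀ : Place ℚ)) 3).restrict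
          (absGaloisRestrict (Place.Completion (Sum.inr v₀ : Place ℚ)) L)).toTopRep),
        (∀ σ, η.1 σ = η₀.1 (absGaloisRestrict (Place.Completion (Sum.inr v₀ : Place ℚ)) L σ)) →
        expStarCoordTower W hL dw η =
          algebraMap (Place.Completion (Sum.inr v₀ : Place ℚ)) L
            (expStarCoord W (valuation_place_lt_one 3 v₀) d η₀))
    (wL : Valuation L ℝ≥0) [wL.Compatible] [(W.baseChange L).IsIntegral wL.integer]
    (η : contOneCocycles ((restrictedTateRep W (Place.Completion (Sum.inr v₀ : Place ℚ)) 3).restrict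
      (absGaloisRestrict (Place.Completion (Sum.inr v₀ : Place ℚ)) L)).toTopRep)
    (P' : (W.baseChange L).toAffine.Point) :
    ‖Algebra.trace ℚ_[3] L
        (expStarCoordTower W hL dw η * padicLogPointFiniteExt wL (W.baseChange L) 3 P')‖ ≤ 1 := by
  -- (0) `ℚ_v ≃ ℚ₃` (Mathlib's `Padic.adicCompletionEquiv`, inverse) and the transported `3`-adic norm
  let e₃ : ℚ_[3] ≃A[ℚ] (v₀).adicCompletion ℚ := Padic.adicCompletionEquiv (𝓞 ℚ) ⟨3, Nat.prime_three⟩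
  let eA0 : (v₀).adicCompletion ℚ ≃ₐ[ℚ] ℚ_[3] := e₃.symm.toAlgEquiv
  let eA : Place.Completion (Sum.inr v₀ : Place ℚ) ≃ₐ[ℚ] ℚ_[3] := eA0
  have heA : ∀ x, eA0 x = e₃.symm x := fun _ => rfl
  have hcont : Continuous eA0.symm := by
    have : ∀ y, eA0.symm y = e₃ y := fun y => by
      apply eA0.injective
      rw [AlgEquiv.apply_symm_apply, heA]
      exact (e₃.symm_apply_apply y).symm
    exact (continuous_congr this).mpr e₃.continuous
  have hball : ∀ x : (v₀).adicCompletion ℚ, ‖eA0 x‖ ≤ 1 ↔ x ∈ (v₀).adicCompletionIntegers ℚ := by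
    intro x
    constructor
    · intro h
      have hx : x = e₃ ((⟨eA0 x, h⟩ : ℤ_[3]) : ℚ_[3]) := by
        change x = e₃ (e₃.symm x)
        exact (e₃.apply_symm_apply x).symm
      rw [hx, ← PadicInt.coe_adicCompletionIntegersEquiv_apply]
      exact SetLike.coe_mem _
    · intro h
      have hx : eA0 x = ((PadicInt.adicCompletionIntegersEquiv (𝓞 ℚ) ⟨3, Nat.prime_three⟩).symm ⟨x, h⟩ : ℚ_[3]) := by
        rw [PadicInt.coe_adicCompletionIntegersEquiv_symm_apply]
        rfl
      rw [hx]
      exact PadicInt.norm_le_one _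
  let w' : Valuation ((v₀).adicCompletion ℚ) ℝ≥0 :=
    (NormedField.valuation (K := ℚ_[3])).comap (eA0 : (v₀).adicCompletion ℚ →+* ℚ_[3])
  let w : Valuation (Place.Completion (Sum.inr v₀ : Place ℚ)) ℝ≥0 := w'
  have hw : ∀ x, w' x = ‖eA0 x‖₊ := fun x => rfl
  haveI : w.Compatible := compatible_of_norm_algEquiv _ v₀ eA0 w' hw hball
  haveI hIv : (W.baseChange ((v₀).adicCompletion ℚ)).IsIntegral w'.integer :=
    isIntegral_baseChange_of_norm_algEquiv eA0 hw W
  haveI : (W.baseChange (Place.Completion (Sum.inr v₀ : Place ℚ))).IsIntegral w.integer := hIv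
  -- (2) the fact at `(ℚ_v, L)`
  obtain ⟨e, he, hA, hB⟩ := hS W (valuation_place_lt_one 3 v₀) w hL wL d dw hinj hex hinjw hexw hresw
  -- (3) the unit step at `ℚ_v`
  set ι : (v₀).adicCompletion ℚ →+* ℚ_[3] :=
    ((Padic.adicCompletionEquiv (𝓞 ℚ) ⟨3, Nat.prime_three⟩).symm : (v₀).adicCompletion ℚ →+* ℚ_[3]) with hιdef
  have hι : ∀ x, ι x = eA x := fun x => rfl
  have hf : ∀ a : ℚ_[3], (∃ y, expStarOmegaPadicAt d hinj hex ι y = a) ↔ ‖a‖ ≤ 1 := fun a =>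
    (hdual a).trans (forall_norm_mul_padicLog_le_one_iff_three W hadd hc ht a)
  have hg : ∀ a : ℚ_[3], (∃ y, expStarOmegaPadicAt (d.smul e he) hinj hex ι y = a) ↔ ‖a‖ ≤ 1 := by
    intro a
    rw [← forall_norm_mul_padicLog_le_one_iff_three W hadd hc ht a]
    have key := hA (eA.symm a)
    -- LEFT: classes vs crossed homomorphisms, `ℚ₃` vs `ℚ_v` values
    have hLft : (∃ y, expStarOmegaPadicAt (d.smul e he) hinj hex ι y = a) ↔
        ∃ η : contOneCocycles (restrictedTateRep W (Place.Completion (Sum.inr v₀ : Place ℚ)) 3).toTopRep,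
          expStarCoord W (valuation_place_lt_one 3 v₀) (d.smul e he) η = eA.symm a := by
      constructor
      · rintro ⟨y, hy⟩
        obtain ⟨η, rfl⟩ := oneCocycleClass_surjective _ y
        refine ⟨η, ?_⟩
        rw [expStarOmegaPadicAt_apply, expStarOmegaAt_eq_expStarCoord] at hy
        rw [← hy]
        exact (eA.symm_apply_apply _).symm
      · rintro ⟨η, hη⟩
        refine ⟨oneCocycleClass _ η, ?_⟩
        rw [expStarOmegaPadicAt_apply, expStarOmegaAt_eq_expStarCoord, hη]
        exact eA.apply_symm_apply a
    -- RIGHT: trace = `eA`, points and logarithms transported along `eA`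
    haveI := isIntegral_valuationInteger_of_isIntegral_padicInt (W.baseChange ℚ_[3])
    have hlog : ∀ P : (W.baseChange (Place.Completion (Sum.inr v₀ : Place ℚ))).toAffine.Point,
        eA (eA.symm a * padicLogPointFiniteExt w (W.baseChange (Place.Completion (Sum.inr v₀ : Place ℚ))) 3 P) =
          a * LocalLog.padicLog (W.baseChange ℚ_[3])
            (WeierstrassCurve.Affine.Point.map (eA : Place.Completion (Sum.inr v₀ : Place ℚ) →ₐ[ℚ] ℚ_[3]) P) := by
      intro P
      rw [map_mul, AlgEquiv.apply_symm_apply, padicLog_eq_padicLogPointFiniteExt]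
      congr 1
      exact (padicLogPointFiniteExt_map_algEquiv eA0 hw W P).symm
    have htr : ∀ x : Place.Completion (Sum.inr v₀ : Place ℚ),
        Algebra.trace ℚ_[3] (Place.Completion (Sum.inr v₀ : Place ℚ)) x = eA x :=
      fun x => trace_eq _ v₀ eA0 Fact.out hcont x
    have hRgt : (∀ P : (W.baseChange (Place.Completion (Sum.inr v₀ : Place ℚ))).toAffine.Point,
        ‖Algebra.trace ℚ_[3] (Place.Completion (Sum.inr v₀ : Place ℚ))
            (eA.symm a * padicLogPointFiniteExt w (W.baseChange (Place.Completion (Sum.inr v₀ : Place ℚ))) 3 P)‖ ≤ 1) ↔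
        ∀ Q : (W.baseChange ℚ_[3]).toAffine.Point, ‖a * LocalLog.padicLog (W.baseChange ℚ_[3]) Q‖ ≤ 1 := by
      constructor
      · intro h Q
        obtain ⟨P, rfl⟩ := exists_map_algEquiv_eq eA0 W Q
        have hP := h P
        rwa [htr, hlog] at hP
      · intro h P
        rw [htr, hlog]
        exact h _
    exact hLft.trans (key.trans hRgt)
  have hrel : ∀ y, expStarOmegaPadicAt (d.smul e he) hinj hex ι y = (ι e)⁻¹ * expStarOmegaPadicAt d hinj hex ι y := by
    intro y
    have hsm : expStarOmegaAt (d.smul e he) y = e⁻¹ * expStarOmegaAt d y :=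
      expStarOmega_smul (valuation_place_lt_one 3 v₀) (galRestrictPlace v₀) d he y
    rw [expStarOmegaPadicAt_apply, expStarOmegaPadicAt_apply, hsm, map_mul, map_inv₀]
    rfl
  have hunit : ‖ι e‖ = 1 := norm_eq_one_of_forall_iff_norm_le_one _ _ (ι e) hf hg hrel
  -- (4) integrality at `L`
  have he' : algebraMap (Place.Completion (Sum.inr v₀ : Place ℚ)) L e ≠ 0 := (map_ne_zero _).mpr he
  have hsmul : ∀ η', expStarCoordTower W hL (dw.smul (algebraMap (Place.Completion (Sum.inr v₀ : Place ℚ)) L e) he') η' =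
      (algebraMap (Place.Completion (Sum.inr v₀ : Place ℚ)) L e)⁻¹ * expStarCoordTower W hL dw η' :=
    fun η' => dw.dualExpCoord_smul he' _
  -- `e` acts on `L` through `ℚ₃ → L` (rigidity of ring maps `ℚ₃ → ℚ_v`, `ℚ₃ → L`)
  have hT : ∀ x : L, Algebra.trace ℚ_[3] L (algebraMap (Place.Completion (Sum.inr v₀ : Place ℚ)) L e * x) =
      ι e * Algebra.trace ℚ_[3] L x := by
    intro x
    have h2 : algebraMap ℚ_[3] (Place.Completion (Sum.inr v₀ : Place ℚ)) (ι e) = e :=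
      (algebraMap_eq_symm 3 v₀ eA0 Fact.out hcont (eA0 e)).trans (eA0.symm_apply_apply e)
    have h3 : (algebraMap (Place.Completion (Sum.inr v₀ : Place ℚ)) L).comp
        (algebraMap ℚ_[3] (Place.Completion (Sum.inr v₀ : Place ℚ))) = algebraMap ℚ_[3] L :=
      LocalField.ringHom_padic_ext _ _
    have h1 : algebraMap (Place.Completion (Sum.inr v₀ : Place ℚ)) L e = algebraMap ℚ_[3] L (ι e) := by
      rw [← h3, RingHom.comp_apply, h2]
    rw [h1, ← Algebra.smul_def, LinearMap.map_smul, smul_eq_mul]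
  refine forall_norm_apply_mul_le_one_of_range (fun η' => expStarCoordTower W hL dw η')
    (fun η' => expStarCoordTower W hL (dw.smul (algebraMap (Place.Completion (Sum.inr v₀ : Place ℚ)) L e) he') η')
    (Algebra.trace ℚ_[3] L) (Set.range fun P : (W.baseChange L).toAffine.Point =>
      padicLogPointFiniteExt wL (W.baseChange L) 3 P)
    _ (ι e) he' hunit.le hT (fun a => (hB a).trans ?_) hsmul η ⟨P', rfl⟩
  rw [Set.forall_mem_range]

end Summit.BirchSwinnertonDyer.BirchSwinnertonDyer.Theorems.KimAtThreeFineKatoHLog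

end
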